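import Mathlib
import HarnessLib

/-!
# Left limits of rational martingales (soft-Markov brick SM2')

Crux `AxiomsOfLimit` (stmt-CriticalPhenomena-1370), line `registered`, stub `stub_markovOfLimit`,
soft-Markov brick SM2' "rational martingale left limits" (lead c4). Theorems only.

For a finite measure `μ`, a filtration `ℱ` indexed by `ℚ` and any `ξ : Ω → ℝ`, almost surely the
`ℚ`-indexed martingale `q ↦ μ[ξ | ℱ q] ω` (Mathlib's chosen versions of the conditional
expectations) has a left limit at EVERY real point `u` along rationals `q ↑ u`
(`stub_leftLimitsAlongRationals`; the square-integrability hypothesis of the registered signature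
is not needed: a non-integrable `ξ` has identically vanishing conditional expectations).

Route (Doob's regularisation along a countable index set, made elementary):
* `le_upcrossingsBefore_of_chain` — `k` interlaced index pairs `σ i ≤ τ i < σ (i+1)` with
  `f (σ i) < a`, `b < f (τ i)` force `k ≤ upcrossingsBefore a b f N` (Mathlib's greedy count);
* `measure_chain_le` — along every finite monotone grid `e : ℕ → ℚ` the discrete martingale
  `j ↦ μ[ξ | ℱ (e j)]` has, by Doob's upcrossing estimate and Markov's inequality, probability
  `≤ (‖ξ‖₁ + |a| μ univ) / ((b - a) k)` of admitting `k` rational upcrossing pairs in the grid;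
* `measure_exists_le_abs_le` — Doob's maximal inequality for `|μ[ξ | ℱ (e j)]|` along a grid;
* `measure_eq_zero_of_finset_bound` — exhausting `ℚ` by increasing finite grids (continuity of
  the measure along increasing unions), the events "`k` rational upcrossings of `[a, b]` for every
  `k`" and "`|μ[ξ | ℱ q]|` unbounded over `q ∈ ℚ`" are null;
* `exists_tendsto_comap_of_finite_upcross` — deterministic: a bounded `f : ℚ → ℝ` with finitely
  many upcrossings of every rational band has a limit along `comap (↑) (𝓝[<] u)` at every real
  `u` (`tendsto_of_no_upcrossings` plus a recursive construction of interlaced crossing pairs).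

Folklore: J. L. Doob, Stochastic Processes (1953), Ch. VII (upcrossing and maximal inequalities,
regularity of sample paths along countable parameter sets). All `[folklore]`.
-/

noncomputable section

open MeasureTheory Filter Topology Set
open scoped ENNReal NNReal

namespace Summit.CriticalPhenomena.SAWScalingLimit.Theorems.AxiomsOfLimitMarkov

/-! ### Combinatorial upcrossings versus Mathlib's greedy count -/

/-- `k` interlaced index pairs `σ i ≤ τ i`, `τ j < σ i` for `j < i`, all with `τ i < N`, along
which `f` passes from below `a` to above `b`, force `k ≤ upcrossingsBefore a b f N`. [folklore] -/
theorem le_upcrossingsBefore_of_chain {Ω : Type*} {f : ℕ → Ω → ℝ} {a b : ℝ} (hab : a < b)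
    {ω : Ω} (σ τ : ℕ → ℕ) :
    ∀ k N : ℕ, (∀ i < k, σ i ≤ τ i ∧ τ i < N ∧ (∀ j < i, τ j < σ i) ∧ f (σ i) ω < a ∧
      b < f (τ i) ω) → k ≤ upcrossingsBefore a b f N ω
  | 0, _, _ => Nat.zero_le _
  | k + 1, N, h => by
    obtain ⟨hστ, hτN, hlt, ha, hb⟩ := h k k.lt_succ_self
    have ih := le_upcrossingsBefore_of_chain hab σ τ k (σ k) fun i hi =>
      let ⟨h1, _, h3, h4, h5⟩ := h i (Nat.lt_succ_of_lt hi)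
      ⟨h1, hlt i hi, h3, h4, h5⟩
    calc k + 1 ≤ upcrossingsBefore a b f (τ k + 1) ω := Nat.succ_le_of_lt
          (ih.trans_lt (upcrossingsBefore_lt_of_exists_upcrossing hab le_rfl ha hστ hb))
      _ ≤ upcrossingsBefore a b f N ω := upcrossingsBefore_mono hab (Nat.succ_le_of_lt hτN) ω

/-! ### Estimates along finite monotone rational grids -/

section Grid

variable {Ω : Type*} {mΩ : MeasurableSpace Ω} (μ : Measure Ω) [IsFiniteMeasure μ]
  (ℱ : Filtration ℚ mΩ) (ξ : Ω → ℝ)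

/-- Doob's upcrossing estimate + Markov along a monotone grid `e : ℕ → ℚ`: the probability that
the rational martingale admits `k` interlaced upcrossing pairs of `[a, b]` with endpoints among
`e 0, …, e (N-1)` is at most `(‖ξ‖₁ + |a| μ univ) / ((b - a) k)`. [folklore] -/
theorem measure_chain_le {e : ℕ → ℚ} (he : Monotone e) (N : ℕ) {a b : ℚ} (hab : a < b)
    {k : ℕ} (hk : 0 < k) :
    μ {ω | ∃ s t : ℕ → ℚ, ∀ i < k, (∃ j < N, e j = s i) ∧ (∃ j < N, e j = t i) ∧ s i < t i ∧
        (∀ j < i, t j < s i) ∧ μ[ξ|ℱ (s i)] ω < a ∧ (b : ℝ) < μ[ξ|ℱ (t i)] ω}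
      ≤ ENNReal.ofReal ((∫ ω, |ξ ω| ∂μ + |(a : ℝ)| * μ.real univ) / (b - a)) / k := by
  have hab' : (a : ℝ) < b := Rat.cast_lt.2 hab
  let 𝒢 : Filtration ℕ mΩ := ⟨fun j => ℱ (e j), fun _ _ h => ℱ.mono (he h), fun j => ℱ.le _⟩
  have hY : Martingale (fun j => μ[ξ|ℱ (e j)]) 𝒢 μ := martingale_condExp ξ 𝒢 μ
  set U := upcrossingsBefore (a : ℝ) b (fun j => μ[ξ|ℱ (e j)]) N
  have hsub : {ω | ∃ s t : ℕ → ℚ, ∀ i < k, (∃ j < N, e j = s i) ∧ (∃ j < N, e j = t i) ∧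
      s i < t i ∧ (∀ j < i, t j < s i) ∧ μ[ξ|ℱ (s i)] ω < a ∧ (b : ℝ) < μ[ξ|ℱ (t i)] ω} ⊆
      {ω | (k : ℝ) ≤ U ω} := by
    rintro ω ⟨s, t, h⟩
    have h1 : ∀ i < k, ∃ j, j < N ∧ e j = s i := fun i hi => (h i hi).1
    have h2 : ∀ i < k, ∃ j, j < N ∧ e j = t i := fun i hi => (h i hi).2.1
    choose! σ hσ using h1
    choose! τ hτ using h2
    have hrefl : ∀ {i j}, e i < e j → i < j := fun h => lt_of_not_ge fun h' => h.not_ge (he h')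
    show (k : ℝ) ≤ U ω
    exact_mod_cast le_upcrossingsBefore_of_chain (f := fun j => μ[ξ|ℱ (e j)]) hab' (ω := ω) σ τ
      k N fun i hi => by
      obtain ⟨-, -, hst, hts, ha, hb⟩ := h i hi
      obtain ⟨hσN, hσe⟩ := hσ i hi
      obtain ⟨hτN, hτe⟩ := hτ i hi
      refine ⟨(hrefl (by rw [hσe, hτe]; exact hst)).le, hτN, fun j hj => hrefl ?_, ?_, ?_⟩
      · rw [(hτ j (hj.trans hi)).2, hσe]; exact hts j hj
      · show μ[ξ|ℱ (e (σ i))] ω < a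
        rw [hσe]; exact ha
      · show (b : ℝ) < μ[ξ|ℱ (e (τ i))] ω
        rw [hτe]; exact hb
  refine (measure_mono hsub).trans ?_
  have hint : Integrable (fun ω => (U ω : ℝ)) μ :=
    hY.stronglyAdapted.integrable_upcrossingsBefore hab'
  have h1 := mul_meas_ge_le_integral_of_nonneg
    (Eventually.of_forall fun ω => (Nat.cast_nonneg (U ω) : (0 : ℝ) ≤ U ω)) hint k
  have h2 := hY.submartingale.mul_integral_upcrossingsBefore_le_integral_pos_part (a : ℝ) b N
  have h3 : ∫ ω, (μ[ξ|ℱ (e N)] ω - a)⁺ ∂μ ≤ ∫ ω, |ξ ω| ∂μ + |(a : ℝ)| * μ.real univ := by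
    calc ∫ ω, (μ[ξ|ℱ (e N)] ω - a)⁺ ∂μ ≤ ∫ ω, (|μ[ξ|ℱ (e N)] ω| + |(a : ℝ)|) ∂μ :=
          integral_mono_of_nonneg (Eventually.of_forall fun ω => posPart_nonneg _)
            (integrable_condExp.abs.add (integrable_const _)) (Eventually.of_forall fun ω =>
              sup_le ((le_abs_self _).trans (abs_sub _ _)) (by positivity))
      _ = ∫ ω, |μ[ξ|ℱ (e N)] ω| ∂μ + |(a : ℝ)| * μ.real univ := by
          rw [integral_add integrable_condExp.abs (integrable_const _), integral_const,
            smul_eq_mul, mul_comm]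
      _ ≤ _ := by linarith [integral_abs_condExp_le (μ := μ) (m := ℱ (e N)) ξ]
  have hba : (0 : ℝ) < b - a := sub_pos.2 hab'
  have hreal : μ.real {ω | (k : ℝ) ≤ U ω} * k ≤
      (∫ ω, |ξ ω| ∂μ + |(a : ℝ)| * μ.real univ) / (b - a) := by
    rw [le_div_iff₀ hba]
    calc μ.real {ω | (k : ℝ) ≤ U ω} * k * (b - a)
          = (b - a) * (k * μ.real {ω | (k : ℝ) ≤ U ω}) := by ring
      _ ≤ (b - a) * ∫ ω, (U ω : ℝ) ∂μ := by gcongr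
      _ ≤ _ := h2.trans h3
  rw [ENNReal.le_div_iff_mul_le (Or.inl (by exact_mod_cast hk.ne'))
    (Or.inl (ENNReal.natCast_ne_top k)), ← ENNReal.ofReal_toReal (measure_ne_top μ _),
    ← ENNReal.ofReal_natCast,
    ← ENNReal.ofReal_mul ENNReal.toReal_nonneg]
  exact ENNReal.ofReal_le_ofReal hreal

/-- Doob's maximal inequality along a monotone grid `e : ℕ → ℚ`: the probability that
`|μ[ξ | ℱ (e j)]| ≥ K` for some `j < N` is at most `‖ξ‖₁ / K`. [folklore] -/
theorem measure_exists_le_abs_le {e : ℕ → ℚ} (he : Monotone e) (N : ℕ) {K : ℕ} (hK : 0 < K) :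
    μ {ω | ∃ j < N, (K : ℝ) ≤ |μ[ξ|ℱ (e j)] ω|} ≤ ENNReal.ofReal (∫ ω, |ξ ω| ∂μ) / K := by
  let 𝒢 : Filtration ℕ mΩ := ⟨fun j => ℱ (e j), fun _ _ h => ℱ.mono (he h), fun j => ℱ.le _⟩
  set Y : ℕ → Ω → ℝ := fun j => μ[ξ|ℱ (e j)]
  have hY : Martingale Y 𝒢 μ := martingale_condExp ξ 𝒢 μ
  have hS := hY.submartingale.sup hY.neg.submartingale
  have h0 : 0 ≤ Y ⊔ -Y := fun j ω => show (0 : ℝ) ≤ |Y j ω| from abs_nonneg _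
  have hmax := maximal_ineq (ε := (K : ℝ≥0)) hS h0 N
  simp only [NNReal.coe_natCast, ENNReal.coe_natCast] at hmax
  set T := {ω | (K : ℝ) ≤ (Finset.range (N + 1)).sup' Finset.nonempty_range_add_one
    fun k => (Y ⊔ -Y) k ω}
  have hI : ∫ ω in T, (Y ⊔ -Y) N ω ∂μ ≤ ∫ ω, |ξ ω| ∂μ :=
    (setIntegral_le_integral (hS.integrable N) (Eventually.of_forall (h0 N))).trans
      (integral_abs_condExp_le (m := ℱ (e N)) ξ)
  have hST : {ω | ∃ j < N, (K : ℝ) ≤ |Y j ω|} ⊆ T := by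
    rintro ω ⟨j, hj, hω⟩
    exact Finset.le_sup'_of_le (f := fun k => (Y ⊔ -Y) k ω)
      (Finset.mem_range.2 (Nat.lt_succ_of_lt hj)) hω
  rw [ENNReal.le_div_iff_mul_le (Or.inl (by exact_mod_cast hK.ne'))
    (Or.inl (ENNReal.natCast_ne_top K)), mul_comm]
  exact ((mul_le_mul' le_rfl (measure_mono hST)).trans hmax).trans (ENNReal.ofReal_le_ofReal hI)

/-! ### Exhausting `ℚ` by finite grids -/

/-- Every finite set of rationals is enumerated by an initial segment of a monotone sequence.
[folklore] -/
theorem exists_monotone_enum (G : Finset ℚ) :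
    ∃ e : ℕ → ℚ, Monotone e ∧ ∃ N, ∀ q ∈ G, ∃ j < N, e j = q := by
  induction G using Finset.induction_on_max with
  | empty => exact ⟨fun _ => 0, monotone_const, 0, by simp⟩
  | insert a s ha ih =>
    obtain ⟨e, he, N, hN⟩ := ih
    refine ⟨fun j => if j < N then min (e j) a else a, fun i j hij => ?_, N + 1, fun q hq => ?_⟩
    · dsimp only
      split_ifs with hi hj hj
      · exact min_le_min (he hij) le_rfl
      · exact min_le_right _ _
      · exact absurd (lt_of_le_of_lt hij hj) hi
      · exact le_rfl
    · rcases Finset.mem_insert.1 hq with rfl | hq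
      · exact ⟨N, N.lt_succ_self, by simp⟩
      · obtain ⟨j, hj, hje⟩ := hN q hq
        exact ⟨j, Nat.lt_succ_of_lt hj, by simp only [if_pos hj, hje, min_eq_left (ha q hq).le]⟩

omit [IsFiniteMeasure μ] in
/-- Null-set principle: if `S` is covered, for every `k ≥ 1`, by events `A k G` attached to finite
sets of rationals, monotone in `G` and of measure `≤ c / k`, then `μ S = 0` (exhaust `ℚ` by an
increasing sequence of finite sets; continuity of `μ` along increasing unions). [folklore] -/
theorem measure_eq_zero_of_finset_bound {S : Set Ω} (A : ℕ → Finset ℚ → Set Ω) {c : ℝ≥0∞}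
    (hc : c ≠ ∞) (hmono : ∀ k, Monotone (A k)) (hS : ∀ k, 0 < k → ∀ ω ∈ S, ∃ G, ω ∈ A k G)
    (hA : ∀ k G, 0 < k → μ (A k G) ≤ c / k) : μ S = 0 := by
  obtain ⟨r, hr⟩ := exists_surjective_nat ℚ
  choose ρ hρ using hr
  have hlim : Tendsto (fun k : ℕ => c / k) atTop (𝓝 0) := by
    simpa only [div_eq_mul_inv, mul_zero] using
      ENNReal.Tendsto.const_mul ENNReal.tendsto_inv_nat_nhds_zero (Or.inr hc)
  refine le_zero_iff.1 (ge_of_tendsto hlim ((eventually_gt_atTop 0).mono fun k hk => ?_))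
  let G : ℕ → Finset ℚ := fun n => (Finset.range (n + 1)).image r
  have hG : Monotone fun n => A k (G n) := fun n m h =>
    hmono k (Finset.image_subset_image (Finset.range_mono (by omega)))
  calc μ S ≤ μ (⋃ n, A k (G n)) := by
        refine measure_mono fun ω hω => ?_
        obtain ⟨G₀, hG₀⟩ := hS k hk ω hω
        refine mem_iUnion.2 ⟨G₀.sup ρ, hmono k (fun q hq => ?_) hG₀⟩
        exact Finset.mem_image.2
          ⟨ρ q, Finset.mem_range.2 (Nat.lt_succ_of_le (Finset.le_sup hq)), hρ q⟩
    _ = ⨆ n, μ (A k (G n)) := hG.measure_iUnion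
    _ ≤ c / k := iSup_le fun n => hA k _ hk

/-- Almost surely the rational martingale `q ↦ μ[ξ | ℱ q] ω` is bounded over `q ∈ ℚ`. [folklore] -/
theorem measure_unbounded_eq_zero :
    μ {ω | ∀ K : ℕ, ∃ q : ℚ, (K : ℝ) ≤ |μ[ξ|ℱ q] ω|} = 0 := by
  refine measure_eq_zero_of_finset_bound μ (fun K G => {ω | ∃ q ∈ G, (K : ℝ) ≤ |μ[ξ|ℱ q] ω|})
    (c := ENNReal.ofReal (∫ ω, |ξ ω| ∂μ)) ENNReal.ofReal_ne_top
    (fun K G G' h ω ⟨q, hq, hω⟩ => ⟨q, h hq, hω⟩)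
    (fun K _ ω hω => let ⟨q, hq⟩ := hω K; ⟨{q}, q, Finset.mem_singleton_self q, hq⟩)
    fun K G hK => ?_
  obtain ⟨e, he, N, hN⟩ := exists_monotone_enum G
  refine (measure_mono ?_).trans (measure_exists_le_abs_le μ ℱ ξ he N hK)
  rintro ω ⟨q, hq, hω⟩
  obtain ⟨j, hj, rfl⟩ := hN q hq
  exact ⟨j, hj, hω⟩

/-- Almost surely, for rationals `a < b`, the rational martingale `q ↦ μ[ξ | ℱ q] ω` does not
admit interlaced rational upcrossing pairs of `[a, b]` of every length. [folklore] -/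
theorem measure_chains_eq_zero {a b : ℚ} (hab : a < b) :
    μ {ω | ∀ k, ∃ s t : ℕ → ℚ, ∀ i < k, s i < t i ∧ (∀ j < i, t j < s i) ∧
      μ[ξ|ℱ (s i)] ω < a ∧ (b : ℝ) < μ[ξ|ℱ (t i)] ω} = 0 := by
  refine measure_eq_zero_of_finset_bound μ
    (fun k G => {ω | ∃ s t : ℕ → ℚ, ∀ i < k, s i ∈ G ∧ t i ∈ G ∧ s i < t i ∧
      (∀ j < i, t j < s i) ∧ μ[ξ|ℱ (s i)] ω < a ∧ (b : ℝ) < μ[ξ|ℱ (t i)] ω})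
    (c := ENNReal.ofReal ((∫ ω, |ξ ω| ∂μ + |(a : ℝ)| * μ.real univ) / (b - a)))
    ENNReal.ofReal_ne_top
    (fun k G G' h ω ⟨s, t, hω⟩ => ⟨s, t, fun i hi =>
      let ⟨h1, h2, h3⟩ := hω i hi; ⟨h h1, h h2, h3⟩⟩)
    (fun k _ ω hω => ?_) fun k G hk => ?_
  · obtain ⟨s, t, h⟩ := hω k
    refine ⟨(Finset.range k).image s ∪ (Finset.range k).image t, s, t, fun i hi => ⟨?_, ?_, h i hi⟩⟩
    · exact Finset.mem_union_left _ (Finset.mem_image_of_mem s (Finset.mem_range.2 hi))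
    · exact Finset.mem_union_right _ (Finset.mem_image_of_mem t (Finset.mem_range.2 hi))
  · obtain ⟨e, he, N, hN⟩ := exists_monotone_enum G
    refine (measure_mono ?_).trans (measure_chain_le μ ℱ ξ he N hab hk)
    rintro ω ⟨s, t, h⟩
    exact ⟨s, t, fun i hi => let ⟨h1, h2, h3⟩ := h i hi; ⟨hN _ h1, hN _ h2, h3⟩⟩

end Grid

/-! ### The deterministic step and the conclusion -/

/-- A bounded `f : ℚ → ℝ` admitting, for all rationals `a < b`, no arbitrarily long interlaced
chains of upcrossing pairs of `[a, b]` has a left limit along rationals at every real point.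
[folklore] -/
theorem exists_tendsto_comap_of_finite_upcross {f : ℚ → ℝ} {K : ℝ} (hK : ∀ q, |f q| ≤ K)
    (hU : ∀ a b : ℚ, a < b → ∃ k : ℕ, ∀ s t : ℕ → ℚ,
      ¬ ∀ i < k, s i < t i ∧ (∀ j < i, t j < s i) ∧ f (s i) < a ∧ (b : ℝ) < f (t i)) (u : ℝ) :
    ∃ L, Tendsto f (comap ((↑) : ℚ → ℝ) (𝓝[<] u)) (𝓝 L) := by
  refine tendsto_of_no_upcrossings Rat.denseRange_cast ?_
    ⟨K, eventually_map.2 (Eventually.of_forall fun q => (abs_le.1 (hK q)).2)⟩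
    ⟨-K, eventually_map.2 (Eventually.of_forall fun q => (abs_le.1 (hK q)).1)⟩
  rintro _ ⟨a, rfl⟩ _ ⟨b, rfl⟩ hab ⟨ha, hb⟩
  rw [((nhdsLT_basis u).comap _).frequently_iff] at ha hb
  choose! σ hσ using ha
  choose! τ hτ using hb
  obtain ⟨k, hk⟩ := hU a b (Rat.cast_lt.1 hab)
  obtain ⟨s, hs0, hs⟩ : ∃ s : ℕ → ℚ, s 0 = σ (u - 1) ∧ ∀ n, s (n + 1) = σ (τ (s n)) :=
    ⟨fun n => Nat.rec (motive := fun _ => ℚ) (σ (u - 1)) (fun _ q => σ (τ q)) n, rfl, fun _ => rfl⟩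
  have h1 : ∀ n, (s n : ℝ) < u ∧ f (s n) < a := by
    intro n
    induction n with
    | zero =>
      have h := hσ (u - 1) (by linarith)
      rw [hs0]; exact ⟨h.1.2, h.2⟩
    | succ n ih =>
      have h := hσ _ (hτ _ ih.1).1.2
      rw [hs]; exact ⟨h.1.2, h.2⟩
  have h2 : ∀ n, (s n : ℝ) < τ (s n) ∧ (τ (s n) : ℝ) < u ∧ (b : ℝ) < f (τ (s n)) := fun n =>
    let h := hτ _ (h1 n).1; ⟨h.1.1, h.1.2, h.2⟩
  have h3 : ∀ n, (τ (s n) : ℝ) < s (n + 1) := fun n => by rw [hs]; exact (hσ _ (h2 n).2.1).1.1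
  have hmono : StrictMono s :=
    strictMono_nat_of_lt_succ fun n => Rat.cast_lt.1 ((h2 n).1.trans (h3 n))
  refine hk s (fun n => τ (s n)) fun i _ => ⟨Rat.cast_lt.1 (h2 i).1, fun j hj => ?_, (h1 i).2,
    (h2 i).2.2⟩
  exact Rat.cast_lt.1 ((h3 j).trans_le (Rat.cast_le.2 (hmono.monotone (Nat.succ_le_of_lt hj))))

/-- **Left limits of rational martingales.** For a finite measure, a filtration indexed by `ℚ`
and any `ξ`, almost surely the map `q ↦ μ[ξ | ℱ q] ω` has a limit along rationals `q ↑ u` at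
every real `u` simultaneously. [folklore] -/
theorem ae_forall_exists_tendsto_condExp_ratCast {Ω : Type*} {mΩ : MeasurableSpace Ω}
    (μ : Measure Ω) [IsFiniteMeasure μ] (ℱ : Filtration ℚ mΩ) (ξ : Ω → ℝ) :
    ∀ᵐ ω ∂μ, ∀ u : ℝ, ∃ L : ℝ, Tendsto (fun q : ℚ => μ[ξ|ℱ q] ω)
      (comap (fun q : ℚ => (q : ℝ)) (𝓝[<] u)) (𝓝 L) := by
  have h1 : ∀ᵐ ω ∂μ, ∃ K : ℕ, ∀ q : ℚ, |μ[ξ|ℱ q] ω| < K := by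
    rw [ae_iff]
    simpa only [not_exists, not_forall, not_lt] using measure_unbounded_eq_zero μ ℱ ξ
  have h2 : ∀ᵐ ω ∂μ, ∀ a b : ℚ, a < b → ∃ k : ℕ, ∀ s t : ℕ → ℚ, ¬ ∀ i < k, s i < t i ∧
      (∀ j < i, t j < s i) ∧ μ[ξ|ℱ (s i)] ω < a ∧ (b : ℝ) < μ[ξ|ℱ (t i)] ω := by
    refine ae_all_iff.2 fun a => ae_all_iff.2 fun b => ?_
    by_cases hab : a < b
    · rw [ae_iff]
      simpa only [hab, true_implies, not_exists, not_forall, not_not] using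
        measure_chains_eq_zero μ ℱ ξ hab
    · exact ae_of_all _ fun _ h => (hab h).elim
  filter_upwards [h1, h2] with ω ⟨K, hK⟩ h2 u
  exact exists_tendsto_comap_of_finite_upcross (fun q => (hK q).le) h2 u

/-- Registered stub `stub_leftLimitsAlongRationals` of crux `AxiomsOfLimit`
(stmt-CriticalPhenomena-1370), line `registered`: for a square-integrable `ξ` and a filtration
indexed by `ℚ`, almost surely `q ↦ μ[ξ | ℱ q] ω` has a left limit along rationals at every real
point. [folklore] -/
theorem stub_leftLimitsAlongRationals : ∀ (Ω : Type) [mΩ : MeasurableSpace Ω] (μ : MeasureTheory.Measure Ω) [MeasureTheory.IsFiniteMeasure μ] (ℱ : MeasureTheory.Filtration ℚ mΩ) (ξ : Ω → ℝ), MeasureTheory.MemLp ξ 2 μ → Filter.Eventually (fun ω => ∀ u : ℝ, ∃ L : ℝ, Filter.Tendsto (fun q : ℚ => MeasureTheory.condExp (ℱ q) μ ξ ω) (Filter.comap (fun q : ℚ => (q : ℝ)) (nhdsWithin u (Set.Iio u))) (nhds L)) (MeasureTheory.ae μ) :=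
  fun _ _ μ _ ℱ ξ _ => ae_forall_exists_tendsto_condExp_ratCast μ ℱ ξ

end Summit.CriticalPhenomena.SAWScalingLimit.Theorems.AxiomsOfLimitMarkov

end
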